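import Summits.Schanuel.Schanuel.Theses.RoyCriterion
import Literature.NumberTheory.Transcendental.RoySmallValueMain

/-!
# `RoySmallValueDirichletGap`: the open content is exactly Roy's gap (support lemma for crux `stmt-Schanuel-1050`)

Since Roy 2013, Theorem 1.1 (Mathematika 59 = arXiv:1301.0663) is PROVED in tree
(`Literature.NumberTheory.Transcendental.roy2013_thm_1_1_holds`), the crux
`Summit.Schanuel.Schanuel.Theses.RoyCriterion.RoySmallValueDirichletGap` (the same statement with the
lower bound on `ν` pushed down to the Dirichlet exponent `2 + β − τ`) is EQUIVALENT to its
restriction to the half-open window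

  `1 < τ < 2`, `β > τ`, `2 + β − τ < ν ≤ 2 + β − τ + (τ−1)(2−τ)/(β+1−τ)`

(`roySmallValueDirichletGap_iff_gap`; the window has width `≤ (τ−1)(2−τ) ≤ 1/4`, Roy 2013 p. 3), and,
because the small-value hypothesis is antitone in `ν`, also to its restriction to
`2 + β − τ < ν ≤ 2 + β − τ + ε` for any fixed `ε > 0` (`roySmallValueDirichletGap_iff_nearEdge`): the
corner `ν ↓ 2 + β − τ` is the whole problem. Everything is proved; no definitions, no named facts.
-/

noncomputable section

namespace Summit.Schanuel.Schanuel.Theorems.RoySmallValueDirichletGapGap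

open MvPolynomial Filter Complex
open Literature.NumberTheory.Transcendental
open Summit.Schanuel.Schanuel.Theses.RoyCriterion (RoySmallValueDirichletGap)

/-- **Open content = the gap case.** [cite: Roy2013, Theorem 1.1 and p. 3] -/
theorem roySmallValueDirichletGap_iff_gap : RoySmallValueDirichletGap ↔
    ∀ (ξ η : ℂ), η ≠ 0 → ∀ (β τ ν : ℝ), 1 < τ → τ < 2 → τ < β → 2 + β - τ < ν →
      ν ≤ 2 + β - τ + (τ - 1) * (2 - τ) / (β + 1 - τ) →
      (∀ᶠ D : ℕ in Filter.atTop, ∃ P : MvPolynomial (Fin 2) ℤ, P ≠ 0 ∧ P.totalDegree ≤ D ∧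
        (mvPolyHeight P : ℝ) ≤ Real.exp ((D : ℝ) ^ β) ∧
        ∀ i : ℕ, i < 3 * ⌊(D : ℝ) ^ τ⌋₊ →
          ‖MvPolynomial.aeval ![ξ, η] (royD^[i] P)‖ ≤ Real.exp (-(D : ℝ) ^ ν)) →
      IsAlgebraic ℚ ξ ∧ IsAlgebraic ℚ η := by
  constructor
  · intro h ξ η hη β τ ν h1 h2 hβ hν _ hP
    exact h ξ η hη β τ ν h1.le h2 hβ hν hP
  · intro h ξ η hη β τ ν h1 h2 hβ hν hP
    rcases lt_or_ge (2 + β - τ + (τ - 1) * (2 - τ) / (β + 1 - τ)) ν with hlt | hle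
    · exact roy2013_thm_1_1_holds ξ η hη β τ ν h1 h2 hβ hlt hP
    · have h1' : 1 < τ := by
        rcases h1.lt_or_eq with h | h
        · exact h
        · exfalso; subst h; norm_num at hle; linarith
      exact h ξ η hη β τ ν h1' h2 hβ hν hle hP

/-- The width of the window is at most `(τ−1)(2−τ) ≤ 1/4`. [cite: Roy2013, p. 3] -/
theorem gap_le_quarter {β τ : ℝ} (h1 : 1 ≤ τ) (h2 : τ < 2) (hβ : τ < β) :
    (τ - 1) * (2 - τ) / (β + 1 - τ) ≤ 1 / 4 := by
  have hden : 1 ≤ β + 1 - τ := by linarith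
  have hnum : (τ - 1) * (2 - τ) ≤ 1 / 4 := by nlinarith [sq_nonneg (τ - 3 / 2)]
  have hnum0 : 0 ≤ (τ - 1) * (2 - τ) := mul_nonneg (by linarith) (by linarith)
  calc (τ - 1) * (2 - τ) / (β + 1 - τ) ≤ (τ - 1) * (2 - τ) / 1 :=
        div_le_div_of_nonneg_left hnum0 one_pos hden
    _ ≤ 1 / 4 := by simpa using hnum

/-- **WLOG `ν` is within `ε` of the Dirichlet edge** (any `ε > 0`), by antitonicity of the
hypothesis in `ν`. [folklore] -/
theorem roySmallValueDirichletGap_iff_nearEdge {ε : ℝ} (hε : 0 < ε) : RoySmallValueDirichletGap ↔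
    ∀ (ξ η : ℂ), η ≠ 0 → ∀ (β τ ν : ℝ), 1 ≤ τ → τ < 2 → τ < β → 2 + β - τ < ν → ν ≤ 2 + β - τ + ε →
      (∀ᶠ D : ℕ in Filter.atTop, ∃ P : MvPolynomial (Fin 2) ℤ, P ≠ 0 ∧ P.totalDegree ≤ D ∧
        (mvPolyHeight P : ℝ) ≤ Real.exp ((D : ℝ) ^ β) ∧
        ∀ i : ℕ, i < 3 * ⌊(D : ℝ) ^ τ⌋₊ →
          ‖MvPolynomial.aeval ![ξ, η] (royD^[i] P)‖ ≤ Real.exp (-(D : ℝ) ^ ν)) →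
      IsAlgebraic ℚ ξ ∧ IsAlgebraic ℚ η := by
  constructor
  · intro h ξ η hη β τ ν h1 h2 hβ hν _ hP
    exact h ξ η hη β τ ν h1 h2 hβ hν hP
  · intro h ξ η hη β τ ν h1 h2 hβ hν hP
    rcases le_or_gt ν (2 + β - τ + ε) with hle | hlt
    · exact h ξ η hη β τ ν h1 h2 hβ hν hle hP
    · refine h ξ η hη β τ (2 + β - τ + ε) h1 h2 hβ (by linarith) le_rfl ?_
      filter_upwards [hP, eventually_ge_atTop 1] with D hD hD1
      obtain ⟨P, hP0, hdeg, hht, hval⟩ := hD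
      refine ⟨P, hP0, hdeg, hht, fun i hi => (hval i hi).trans ?_⟩
      have hD1' : (1 : ℝ) ≤ D := by exact_mod_cast hD1
      exact Real.exp_le_exp.2 (neg_le_neg (Real.rpow_le_rpow_of_exponent_le hD1' hlt.le))

end Summit.Schanuel.Schanuel.Theorems.RoySmallValueDirichletGapGap

end
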